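import Summits.ResolutionOfSingularities.ResolutionOfSingularities.Theorems.MarkedTransferCampaignW46WWalkNRStepSep
import Summits.ResolutionOfSingularities.ResolutionOfSingularities.Theorems.MarkedTransferCampaignW46WWalkNRSeparable
import Summits.ResolutionOfSingularities.ResolutionOfSingularities.Theorems.MarkedTransferCampaignW46WWalkNRThread
import Summits.ResolutionOfSingularities.ResolutionOfSingularities.Theorems.MarkedTransferCampaignW46WWalkNRTwist
import Summits.ResolutionOfSingularities.ResolutionOfSingularities.Theorems.MarkedTransferCampaignW46MohWindowShadeFormalNRWalkStep
import HarnessLib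

/-!
# [OURS · L1 W4.6 rung (iii-2), NON-RATIONAL W-WALK over an ARBITRARY ground field, brick 16] ONE STEP ALONG A HIT THREAD with `w`-anchors
# over ARBITRARY coefficient fields (brick 6 without perfectness; the separability of the new digit comes from the regime via brick 13)

Cell `res-hironaka`, LADDER-RESOLUTION rung L (D-0089), slot W4.6 rung (iii); seat res-L1-s46-pv-6 (gen 8). Host route MarkedTransfer,
`--supports stmt-ResolutionOfSingularities-16155 --as helper`; kind proof (no definition). IMPERFECT-`K` ROAD (res-L1-s46-pv-5's `W-WALK-PLAN.md`
§7.2 (c)): brick 6 (`…WWalkNRThread.wNRAnchor_succ`, p576802) VERBATIM except that the anchors' coefficient fields `L` are ANY fields of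
characteristic `p` (no `PerfectField L`), the step is brick 14's `exists_wAnchor_step_nr_sep`, whose separability input is DISCHARGED here from the
regime at the two consecutive thread points by brick 13's `separable_map_residue_of_window_child` (pv-5's `false_of_inseparable_child`), and the
separability of the minimal polynomial `π` of the new digit is the step's output instead of `PerfectField.separable_of_irreducible`.

WHAT. At stage `k` the thread point carries a `w`-anchor `e(f₀) = w · (z^p + f^L)` over SOME field `L ↪ Ω` of characteristic `p` (image the COEFFICIENT
SUBFIELD `Λ`), with `LowVanish (p+1)` and `BDiv r_t r_y` for the `Ω`-residual `f = f^L ⊗ Ω`. One step (`wNRAnchor_succ_general`): the same at stage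
`k + 1` for `(f′, r_t′, r_y′, Λ′)`; at a HIT stage `f′ = stepT p l γ f` (a `T`-step at the image `l ∈ Ω` of the point) or
`f′ = stepT p 0 γ (swapTY f)` (sharp-vertical; then `l = 0`) exactly as in pv-5's `wAnchor_succ` (cleaning root `γ` read off o1's presentation at the
child, `γ = 0` whenever the kept letter is present), and the FIELD DATA: `Λ ≤ Λ′ ∋ l, γ`; `l ∈ Λ ⇒ Λ′ ≤ Λ`; and a polynomial `π ∈ Λ[X]`,
irreducible and separable, with root `l` (the minimal polynomial of the point's coordinate on the exceptional line — the input of the W-degree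
law `…WWalkNRBaseChange.natDegree_mul_shade_le`). Off the centre everything is carried verbatim.

HONEST FRAMING. OURS; nothing here is a statement of H. Hironaka's manuscript [Hironaka2017] and nothing of it is used. AI-written;
AI review is weaker than expert review. No `sorry`; axioms standard. [cite: StacksProject, Tag 0804] [cite: Matsumura1987, Thm. 8.11]
[cite: Hauser2010, §§F–G] [folklore]
-/

noncomputable section

set_option linter.dupNamespace false -- mandated namespace of this single-conjunct summit

open MvPowerSeries IsLocalRing Finset
open Literature.AlgebraicGeometry.Resolution
open Literature.RingTheory.MvPowerSeries.Jets (mem_maximalIdeal_iff_constantCoeff_eq_zero mem_maximalIdeal_pow_iff)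

namespace Summit.ResolutionOfSingularities.ResolutionOfSingularities.Theorems

namespace CampaignW46

namespace WWalkNR

open CategoryTheory AlgebraicGeometry TopologicalSpace
open Literature.AlgebraicGeometry.Hironaka2017.S02Preliminaries
open Literature.AlgebraicGeometry.Hironaka2017.Datum
open Scheme.IdealSheafData
open WWalk
open CampaignW46.FormalChart (ringEquiv_mem_maximalIdeal ringEquiv_mem_maximalIdeal_pow)
open CampaignW46.AtomGerm (mem_maximalIdeal_pow_iff_algebraMap)
open MohWindowShadeFormalNR (exists_formalNRAnchor_offCentre eval_map_mem_of_mem order_map_of_injective)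

/-! ## §1 One step along a hit thread, any ground field -/

section Thread

variable {p : ℕ} [hp : Fact p.Prime] {K : Type} [Field K] [CharP K p]
  {Ω : Type} [Field Ω] [IsAlgClosed Ω] [DecidableEq Ω]

/-- **ONE STEP ALONG A HIT THREAD, `w`-anchors over the residue fields of the points, model in `Ω⟦t,y,z⟧`.** [OURS · L1 W4.6 rung (iii-2)]
NOT a statement of the manuscript. See the module docstring. [cite: StacksProject, Tag 0804] [cite: Matsumura1987, Thm. 8.11] -/
theorem wNRAnchor_succ_general (r : PermissibleRun p K) (hr : ∀ k, regimeMohWindowSurfaceInsep (p := p) (K := K) (r.A k) (r.E k))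
    (t : r.HitThread) (k : ℕ) (f : MvPowerSeries (Option (Fin 2)) Ω) (rt ry : ℕ) (Λ : Subfield Ω)
    (hA : ∃ (L : Type) (_ : Field L) (_ : CharP L p) (ι : L →+* Ω)
      (e : AdicCompletion (maximalIdeal ((r.A k).Z.presheaf.stalk (t.y k))) ((r.A k).Z.presheaf.stalk (t.y k)) ≃+* MvPowerSeries (Option (Fin 2)) L)
      (f₀ : (r.A k).Z.presheaf.stalk (t.y k)) (w fL : MvPowerSeries (Option (Fin 2)) L),
      ι.fieldRange = Λ ∧ stalkIdeal (r.E k).J (t.y k) = Ideal.span {f₀} ∧ IsUnit w ∧ e (algebraMap _ _ f₀) = w * (X none ^ p + fL) ∧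
        MvPowerSeries.map ι fL = f)
    (hP2 : LowVanish (p + 1) f) (hB : BDiv rt ry f) :
    ∃ (f' : MvPowerSeries (Option (Fin 2)) Ω) (rt' ry' : ℕ) (Λ' : Subfield Ω) (v : Bool) (l γ : Ω),
      ((r.D k : Set (r.A k).Z) = {t.y k} →
        (v = false → f' = stepT p l γ f ∧ rt' = f.order.toNat - p ∧ ry' = (if l = 0 then ry else 0) ∧ (l = 0 → 0 < ry → γ = 0)) ∧
        (v = true → f' = stepT p 0 γ (swapTY f) ∧ rt' = f.order.toNat - p ∧ ry' = rt ∧ (0 < rt → γ = 0)) ∧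
        Λ ≤ Λ' ∧ γ ∈ Λ' ∧ l ∈ Λ' ∧ (l ∈ Λ → Λ' ≤ Λ) ∧ (v = true → l = 0) ∧
        (∃ π : Polynomial Λ, Irreducible π ∧ π.Separable ∧ (π.map Λ.subtype).IsRoot l)) ∧
      ((r.D k : Set (r.A k).Z) ≠ {t.y k} → f' = f ∧ rt' = rt ∧ ry' = ry ∧ Λ' = Λ) ∧
      (∃ (L : Type) (_ : Field L) (_ : CharP L p) (ι : L →+* Ω)
        (e : AdicCompletion (maximalIdeal ((r.A (k + 1)).Z.presheaf.stalk (t.y (k + 1)))) ((r.A (k + 1)).Z.presheaf.stalk (t.y (k + 1))) ≃+*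
          MvPowerSeries (Option (Fin 2)) L)
        (f₀ : (r.A (k + 1)).Z.presheaf.stalk (t.y (k + 1))) (w fL : MvPowerSeries (Option (Fin 2)) L),
        ι.fieldRange = Λ' ∧ stalkIdeal (r.E (k + 1)).J (t.y (k + 1)) = Ideal.span {f₀} ∧ IsUnit w ∧
          e (algebraMap _ _ f₀) = w * (X none ^ p + fL) ∧ MvPowerSeries.map ι fL = f') ∧
      LowVanish (p + 1) f' ∧ BDiv rt' ry' f' := by
  classical
  obtain ⟨L, _instF, _instC, ι, e, f₀, w, fL, hΛ, hJ, hw, hE, hfmap⟩ := hA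
  subst hΛ
  have hc := t.compat k
  have hmem : (r.π k).base (t.y (k + 1)) ∈ (r.E k).sing := by rw [hc]; exact t.mem k
  obtain ⟨hR, h3, hcl, -, hb⟩ := MohWindowShadeAnchorWalk.regime_point (hr k) hmem
  haveI := hR
  obtain ⟨hR', h3', -, -, hb'⟩ := MohWindowShadeAnchorWalk.regime_point (hr (k + 1)) (t.mem (k + 1))
  -- move the anchor to the point `π (y (k+1))`
  have hA' : ∃ (e : AdicCompletion (maximalIdeal ((r.A k).Z.presheaf.stalk ((r.π k).base (t.y (k + 1)))))
        ((r.A k).Z.presheaf.stalk ((r.π k).base (t.y (k + 1)))) ≃+* MvPowerSeries (Option (Fin 2)) L)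
      (f₀ : (r.A k).Z.presheaf.stalk ((r.π k).base (t.y (k + 1)))),
      stalkIdeal (r.E k).J ((r.π k).base (t.y (k + 1))) = Ideal.span {f₀} ∧ e (algebraMap _ _ f₀) = w * (X none ^ p + fL) := by
    rw [hc]; exact ⟨e, f₀, hJ, hE⟩
  obtain ⟨e, f₀, hJ, hE⟩ := hA'
  -- facts over `L` and over `Ω`
  have hP2L : LowVanish (p + 1) fL := (lowVanish_map_iff ι (p + 1) fL).mp (by rw [hfmap]; exact hP2)
  have hBL : BDiv rt ry fL := (bdiv_map_iff ι rt ry fL).mp (by rw [hfmap]; exact hB)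
  obtain ⟨d, hdL, hpd, hd2, hlowdL, -, -⟩ := residual_facts (hr k) hmem e hJ hw hE hP2L hBL
  have hd : f.order = d := by rw [← hfmap, order_map_of_injective ι ι.injective, hdL]
  have hdto : f.order.toNat = d := by rw [hd]; rfl
  have hlowd : LowVanish d f := by rw [← hfmap]; exact (lowVanish_map_iff ι d fL).mpr hlowdL
  have hsing' : t.y (k + 1) ∈ ((r.E k).transform (r.π k) (r.D k)).sing := by
    have := t.mem (k + 1); rwa [r.E_succ k] at this
  haveI : IsDomain ((r.A (k + 1)).Z.presheaf.stalk (t.y (k + 1))) := by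
    haveI := hR'; exact isDomain_of_isRegularLocalRing _
  have hcoeff' : MohWindowSurfaceCoeffAt p ((r.A (k + 1)).Z.presheaf.stalk (t.y (k + 1))) (stalkIdeal (r.E (k + 1)).J (t.y (k + 1))) :=
    coeffAt_of_regime (hr (k + 1)) (t.mem (k + 1))
  by_cases hhit : (r.D k : Set (r.A k).Z) = {t.y k}
  · -- the thread point is blown up: the non-rational formal `w`-step
    have hD : (r.D k : Set (r.A k).Z) = {(r.π k).base (t.y (k + 1))} := by rw [hc]; exact hhit
    -- separability of `κ(y_{k+1}) / κ(y_k)` from the regime at the two points (brick 13, pv-5's `false_of_inseparable_child`)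
    have hwin' : MohWindowSurfaceAt p ((r.A (k + 1)).Z.presheaf.stalk (t.y (k + 1)))
        (stalkIdeal (((r.E k).transform (r.π k) (r.D k))).J (t.y (k + 1))) := by
      have h := ((Regime.mohWindowSurfaceIsolated_iff _ _).mp ((regimeMohWindowSurfaceInsep_iff _ _).mp (hr (k + 1))).1).2
        (t.y (k + 1)) (t.mem (k + 1))
      rw [r.E_succ k] at h
      have hbT : ((r.E k).transform (r.π k) (r.D k)).b = p := hb
      rw [hbT] at h
      exact h
    have hsepL := separable_map_residue_of_window_child (r.π k) (r.D k) (r.blowup k) hb hD (coeffAt_of_regime (hr k) hmem) hsing' hwin'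
    obtain ⟨K₁, _i1, _i2, ι₁, E', f', w', f₁, π₀, v, l, hsub, hirr, hsep, -, hroot, ⟨yl, hyl⟩, hgenK₁, hJ', hw', hE', hT, hV⟩ :=
      exists_wAnchor_step_nr_sep ι (r.π k) (r.D k) (r.blowup k) hb hD hmem hsing' h3 hR' h3' e hJ hw fL hP2L hE
        fun ρR y hρ hy => hsepL ρR hρ y hy
    have hJ'' : stalkIdeal (r.E (k + 1)).J (t.y (k + 1)) = Ideal.span {f'} := by rw [r.E_succ k]; exact hJ'
    -- `f' ∈ 𝔪^p`, so `f₁` has order `≥ p`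
    haveI := hR'
    have hf'𝔪 : f' ∈ maximalIdeal ((r.A (k + 1)).Z.presheaf.stalk (t.y (k + 1))) ^ p := by
      have h := (le_idealOrder_iff (r.E (k + 1)).J (t.y (k + 1)) (r.E (k + 1)).b).mp (t.mem (k + 1))
      rw [hJ'', Ideal.span_singleton_le_iff_mem, hb'] at h
      exact h
    have hlow₁ : LowVanish p f₁ := by
      have h1 : w' * (X none ^ p + f₁) ∈ maximalIdeal (MvPowerSeries (Option (Fin 2)) K₁) ^ p := by
        rw [← hE']; exact ringEquiv_mem_maximalIdeal_pow E' ((mem_maximalIdeal_pow_iff_algebraMap p f').mp hf'𝔪)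
      have h2 : X none ^ p + f₁ ∈ maximalIdeal (MvPowerSeries (Option (Fin 2)) K₁) ^ p := (Ideal.unit_mul_mem_iff_mem _ hw').mp h1
      have h3 : f₁ ∈ maximalIdeal (MvPowerSeries (Option (Fin 2)) K₁) ^ p := by
        have : f₁ = (X none ^ p + f₁) - X none ^ p := by ring
        rw [this]
        exact Ideal.sub_mem _ h2 (Ideal.pow_mem_pow (mem_maximalIdeal_iff_constantCoeff_eq_zero.mpr (constantCoeff_X _)) p)
      exact mem_maximalIdeal_pow_iff.mp h3
    -- field data common to both cases
    have hΛle : ι.fieldRange ≤ ι₁.fieldRange := by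
      rintro x ⟨a, rfl⟩
      obtain ⟨y, hy⟩ := hsub a
      exact ⟨y, hy⟩
    have hlmem : l ∈ ι₁.fieldRange := ⟨yl, hyl⟩
    have hΛ'le : l ∈ ι.fieldRange → ι₁.fieldRange ≤ ι.fieldRange := by
      rintro hl x ⟨z, rfl⟩
      obtain ⟨P, hP⟩ := hgenK₁ z
      rw [hP]
      exact eval_map_mem_of_mem ι P hl
    have hπ : ∃ π : Polynomial ι.fieldRange, Irreducible π ∧ π.Separable ∧ (π.map ι.fieldRange.subtype).IsRoot l :=
      exists_irreducible_over_fieldRange ι hirr hsep hroot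
    -- the uncleaned `Ω`-residual and its shape
    have key : ∀ (g : MvPowerSeries (Option (Fin 2)) Ω) (lΩ : Ω), LowVanish (p + 1) g → MvPowerSeries.map ι₁ f₁ = chartT p lΩ g →
        ∃ β' : K₁, (∀ a b cz, a + b + cz = p → a ≠ p → coeff (mk3 a b cz) (chartT p lΩ g) = 0) ∧
          coeff (mk3 p 0 0) (chartT p lΩ g) = (ι₁ β') ^ p ∧
          ∃ (E'' : AdicCompletion (maximalIdeal ((r.A (k + 1)).Z.presheaf.stalk (t.y (k + 1)))) ((r.A (k + 1)).Z.presheaf.stalk (t.y (k + 1))) ≃+*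
              MvPowerSeries (Option (Fin 2)) K₁) (w'' fL' : MvPowerSeries (Option (Fin 2)) K₁),
            IsUnit w'' ∧ E'' (algebraMap _ _ f') = w'' * (X none ^ p + fL') ∧ MvPowerSeries.map ι₁ fL' = stepT p lΩ (ι₁ β') g := by
      intro g lΩ hg hf₁
      have hfz : coeff (mk3 0 0 p) f₁ = 0 := (map_eq_zero_iff ι₁ ι₁.injective).mp (by
        rw [← MvPowerSeries.coeff_map, hf₁]; exact coeff_chartT_texp_zero hg 0 p)
      have hfy : coeff (mk3 0 p 0) f₁ = 0 := (map_eq_zero_iff ι₁ ι₁.injective).mp (by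
        rw [← MvPowerSeries.coeff_map, hf₁]; exact coeff_chartT_texp_zero hg p 0)
      obtain ⟨hdeg, β', hβ'⟩ := cleaningData_of_wAnchor hcoeff' E' hJ'' hw' hE' hfz hfy
      obtain ⟨E'', w'', hw'', hE''⟩ := exists_ringEquiv_clean_general E' (algebraMap _ _ f') w' hw' β' f₁ hE'
      refine ⟨β', fun a b cz habc ha => ?_, ?_, E'', w'', _, hw'', hE'', map_shearZ_clean ι₁ β' f₁ lΩ g hf₁⟩
      · rw [← hf₁, MvPowerSeries.coeff_map, hdeg a b cz habc ha, map_zero]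
      · rw [← hf₁, MvPowerSeries.coeff_map, hβ', map_pow]
    cases hv : v with
    | false =>
      -- `T`-step at `(1 : l : 0)`
      have hf₁Ω : MvPowerSeries.map ι₁ f₁ = chartT p l f := by rw [← hfmap]; exact hT hv
      obtain ⟨β', hdegΩ, hβ'Ω, E'', w'', fL', hw'', hE'', hfL'⟩ := key f l hP2 hf₁Ω
      have hγ0 : l = 0 → 0 < ry → ι₁ β' = 0 := by
        intro hl hry
        have h0 : coeff (mk3 p 0 0) (chartT p l f) = 0 := by rw [hl]; exact coeff_chartT_eq_zero_of_lt_ry hB hry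
        rw [h0] at hβ'Ω
        exact (pow_eq_zero_iff hp.out.ne_zero).mp hβ'Ω.symm
      refine ⟨stepT p l (ι₁ β') f, d - p, if l = 0 then ry else 0, ι₁.fieldRange, false, l, ι₁ β',
        fun _ => ⟨fun _ => ⟨rfl, by rw [hdto], rfl, hγ0⟩, fun h => absurd h (by decide), hΛle, ⟨β', rfl⟩, hlmem, hΛ'le,
          fun h => absurd h (by decide), hπ⟩,
        fun h => absurd hhit h, ⟨K₁, _i1, _i2, ι₁, E'', f', w'', fL', rfl, hJ'', hw'', hE'', hfL'⟩, ?_, ?_⟩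
      · exact lowVanish_succ_stepT (fun e' he' => by rw [← hf₁Ω, MvPowerSeries.coeff_map, hlow₁ e' he', map_zero]) hdegΩ hβ'Ω
      · exact bdiv_stepT hlowd hB hpd (by omega) hγ0
    | true =>
      -- sharp-vertical step at `(0 : 1 : 0)`
      obtain ⟨hl0, hf₁Ω'⟩ := hV hv
      have hf₁Ω : MvPowerSeries.map ι₁ f₁ = chartT p (0 : Ω) (swapTY f) := by rw [← hfmap]; exact hf₁Ω'
      have hP2s : LowVanish (p + 1) (swapTY f) := lowVanish_swapTY hP2
      have hBs : BDiv ry rt (swapTY f) := bdiv_swapTY hB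
      obtain ⟨β', hdegΩ, hβ'Ω, E'', w'', fL', hw'', hE'', hfL'⟩ := key (swapTY f) 0 hP2s hf₁Ω
      have hγ0 : (0 : Ω) = 0 → 0 < rt → ι₁ β' = 0 := by
        intro _ hrt
        have h0 : coeff (mk3 p 0 0) (chartT p (0 : Ω) (swapTY f)) = 0 := coeff_chartT_eq_zero_of_lt_ry hBs hrt
        rw [h0] at hβ'Ω
        exact (pow_eq_zero_iff hp.out.ne_zero).mp hβ'Ω.symm
      refine ⟨stepT p 0 (ι₁ β') (swapTY f), d - p, rt, ι₁.fieldRange, true, l, ι₁ β',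
        fun _ => ⟨fun h => absurd h (by decide), fun _ => ⟨rfl, by rw [hdto], rfl, hγ0 rfl⟩, hΛle, ⟨β', rfl⟩, hlmem, hΛ'le,
          fun _ => hl0, hπ⟩,
        fun h => absurd hhit h, ⟨K₁, _i1, _i2, ι₁, E'', f', w'', fL', rfl, hJ'', hw'', hE'', hfL'⟩, ?_, ?_⟩
      · exact lowVanish_succ_stepT (fun e' he' => by rw [← hf₁Ω, MvPowerSeries.coeff_map, hlow₁ e' he', map_zero]) hdegΩ hβ'Ω
      · have h := bdiv_stepT (l := (0 : Ω)) (γ := ι₁ β') (lowVanish_swapTY hlowd) hBs hpd (by omega) hγ0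
        rw [if_pos rfl] at h
        exact h
  · -- the thread point is not blown up: transport
    obtain ⟨ξ₀, -, -, hDξ₀⟩ := IsPermissibleCentre.exists_eq_singleton_of_isolatedSing (r.permissible k)
      ((regimeMohWindowSurfaceInsep_iff _ _).mp (hr k)).1.1
    have hoff : (r.π k).base (t.y (k + 1)) ∉ (r.D k : Set (r.A k).Z) := by
      rw [hc, hDξ₀, Set.mem_singleton_iff]
      rintro rfl
      exact hhit hDξ₀
    obtain ⟨e', f', hJ', hE'⟩ := exists_formalNRAnchor_offCentre (E := r.E k) (r.π k) (r.blowup k) hoff e hJ _ hE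
    refine ⟨f, rt, ry, ι.fieldRange, false, 0, 0, fun h => absurd h hhit, fun _ => ⟨rfl, rfl, rfl, rfl⟩,
      ⟨L, _instF, _instC, ι, e', f', w, fL, rfl, ?_, hw, hE', hfmap⟩, hP2, hB⟩
    rw [r.E_succ k]; exact hJ'

end Thread

end WWalkNR

end CampaignW46

end Summit.ResolutionOfSingularities.ResolutionOfSingularities.Theorems

end
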